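import Literature.NumberTheory.EllipticCurves.ModularCurveIharaLemma
import HarnessLib

/-!
# Two-prime old-space exactness ON CYCLES: the FULL complex implies the SIGNED one (cell `b2b-bsdres`, seat additive-p4 gen 33, line V56 — cycle-level bridge for the typed target T-V54)

HONEST FRAMING (verbatim, cell `b2b-bsdres`): the goal of the cell is to DELETE the COMBINATION-SHAPED
residual classes for ALL analytic-rank `≤ 1` curves over `ℚ` — "full BSD formula for every rank `≤ 1`
curve in class `C`" assembled STRICTLY from published theorems — so that the rank-`≤ 1` remainder
becomes exactly the CONSTRUCTION-SHAPED classes, which are TYPED (missing-input Props), NOT attempted;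
this is not "finishing BSD". This file: TOOL theorem (pure algebra of additive functionals on the
integral homology `H₁(X₀(·), ℤ) = periodHomology ·`), 0 defs, 0 facts, nothing booked; X4
CONSTRUCTION-SHAPED; no mark moves.

## Why

`X4/PathFunctionExactOfCycles.exact_pathFun_of_exact_cycles` (gen 32, K95) and the assembly
`X4/KuriharaAdditiveCertificateOfCycles` (K97) take CYCLE-LEVEL exactness of the SIGNED old-space
complex (hypothesis `hexactC`: families `𝓛₁, 𝓛₂, 𝓛₀` of functionals on `H₁(X₀(M₁))`, `H₁(X₀(M₂))`,
`H₁(X₀(M₀))`, degeneracy pull-backs `(degeneracyMap0 · · c 2).dualMap`). The literature's statement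
— the level-raising/level-lowering complex of Calegari–Venkatesh (Astérisque 409, §(10.2) and Ch. 4:
row `E¹_{•,1}` of the spectral sequence of `Γ₀(M₀; ℤ[1/ℓ₁ℓ₂])` on the product of two trees, whose
exactness at non-Eisenstein `𝔪` is the `i = 2` case of their Conjecture 4.1) — is the FULL complex
with BOTH degeneracy copies at each prime. This file proves, on cycles, FULL middle exactness +
two-copy (one-prime) injectivity at the bottom level ⟹ the SIGNED `hexactC`, for every pair of signs
`(w₁, w₂)` (`signedExactCycles_of_fullExactCycles`). The two-copy injectivities are the dual
(functional) form of Ihara's lemma `ribet1984_iharaLemma` for `𝔫`-supported families (cf.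
`X4/PathFunctionInjectiveOfIhara`). Function-level twins: `X4/TwoPrimeExactnessBridges.lean`.

## References

* F. Calegari, A. Venkatesh, *A torsion Jacquet–Langlands correspondence*, Astérisque 409 (2019), §(10.2), Ch. 4 Thm 35, Conj. 4.1. [cite: CalegariVenkatesh2019, Ch. 4, Conj. 4.1]
* K. Ribet, Proc. ICM 1983 (1984), Thm. 4.1; H. Darmon, F. Diamond, R. Taylor (1995), Lemma 4.28. [cite: Ribet1984ICM, Thm. 4.1] [cite: DarmonDiamondTaylor1995, Lemma 4.28]
* F. Diamond, R. Taylor, Invent. Math. 115 (1994), Thm. 2. [cite: DiamondTaylor1994, Thm. 2]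
-/

noncomputable section

open scoped MatrixGroups ModularForm

open CongruenceSubgroup

open Literature.NumberTheory.EllipticCurves Literature.NumberTheory.EllipticCurves.ModularForms

namespace Summit.BirchSwinnertonDyer.Rank1Residual.LevelLowering

section CyclesBridge

variable {k : Type*} [CommRing k]

/-- **SIGNED CYCLE-EXACTNESS FROM FULL CYCLE-EXACTNESS.** Levels `M₀ ∣ M₁, M₂ ∣ N` with
`M₀ℓ₂ ∣ M₁`, `M₀ℓ₁ ∣ M₂`, `M₁ℓ₁ ∣ N`, `M₂ℓ₂ ∣ N` (`M₁ = N/ℓ₁`, `M₂ = N/ℓ₂`, `M₀ = N/ℓ₁ℓ₂`); families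
`𝓛₁, 𝓛₂, 𝓛₀` of `k`-valued functionals; `𝓛₁` (resp. `𝓛₂`) closed under `Λ ↦ −w₁Λ` (resp. `−w₂Λ`), `𝓛₀`
under `(Z, Z') ↦ Z + wZ'`. FULL middle exactness on cycles: every `(Λ₁, Λ₁', Λ₂, Λ₂') ∈ 𝓛₁² × 𝓛₂²` with
`Λ₁∘d¹₁ + Λ₁'∘d¹_{ℓ₁} + Λ₂∘d²₁ + Λ₂'∘d²_{ℓ₂} = 0` on `H₁(X₀(N))` is
`(Z₁∘d₁ + Z₂∘d_{ℓ₂}, Z₃∘d₁ + Z₄∘d_{ℓ₂}, −(Z₁∘d₁ + Z₃∘d_{ℓ₁}), −(Z₂∘d₁ + Z₄∘d_{ℓ₁}))` on cycles, `Zᵢ ∈ 𝓛₀`.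
Two-copy injectivity (Ihara, dual form) at `ℓ₂` from `M₀` to `M₁` (both components) and at `ℓ₁`
from `M₀` to `M₂` (first component). THEN the SIGNED complex is exact on cycles — literally the
hypothesis `hexactC` of `exact_pathFun_of_exact_cycles`.
[cite: CalegariVenkatesh2019, Ch. 4, Conj. 4.1] [cite: Ribet1984ICM, Thm. 4.1] -/
theorem signedExactCycles_of_fullExactCycles {M₀ M₁ M₂ N ℓ₁ ℓ₂ : ℕ}
    [NeZero M₀] [NeZero M₁] [NeZero M₂] [NeZero N] [NeZero ℓ₁] [NeZero ℓ₂]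
    (h01' : M₀ * ℓ₂ ∣ M₁) (h02' : M₀ * ℓ₁ ∣ M₂) (w₁ w₂ : k)
    (𝓛₁ : Set (Module.Dual ℂ (CuspForm (Gamma0 M₁) 2) → k))
    (𝓛₂ : Set (Module.Dual ℂ (CuspForm (Gamma0 M₂) 2) → k))
    (𝓛₀ : Set (Module.Dual ℂ (CuspForm (Gamma0 M₀) 2) → k))
    (hs₁ : ∀ Λ ∈ 𝓛₁, (fun x ↦ -(w₁ * Λ x)) ∈ 𝓛₁)
    (hs₂ : ∀ Λ ∈ 𝓛₂, (fun x ↦ -(w₂ * Λ x)) ∈ 𝓛₂)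
    (hlin₀ : ∀ Z ∈ 𝓛₀, ∀ Z' ∈ 𝓛₀, ∀ w : k, (fun x ↦ Z x + w * Z' x) ∈ 𝓛₀)
    -- FULL CYCLE-LEVEL EXACTNESS
    (hfullC : ∀ Λ₁ ∈ 𝓛₁, ∀ Λ₁' ∈ 𝓛₁, ∀ Λ₂ ∈ 𝓛₂, ∀ Λ₂' ∈ 𝓛₂,
      (∀ y ∈ periodHomology N,
        Λ₁ ((degeneracyMap0 M₁ N 1 2).dualMap y) + Λ₁' ((degeneracyMap0 M₁ N ℓ₁ 2).dualMap y) +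
        (Λ₂ ((degeneracyMap0 M₂ N 1 2).dualMap y) + Λ₂' ((degeneracyMap0 M₂ N ℓ₂ 2).dualMap y)) = 0) →
      ∃ Z₁ ∈ 𝓛₀, ∃ Z₂ ∈ 𝓛₀, ∃ Z₃ ∈ 𝓛₀, ∃ Z₄ ∈ 𝓛₀,
        (∀ x ∈ periodHomology M₁, Λ₁ x =
          Z₁ ((degeneracyMap0 M₀ M₁ 1 2).dualMap x) + Z₂ ((degeneracyMap0 M₀ M₁ ℓ₂ 2).dualMap x)) ∧
        (∀ x ∈ periodHomology M₁, Λ₁' x =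
          Z₃ ((degeneracyMap0 M₀ M₁ 1 2).dualMap x) + Z₄ ((degeneracyMap0 M₀ M₁ ℓ₂ 2).dualMap x)) ∧
        (∀ x ∈ periodHomology M₂, Λ₂ x =
          -(Z₁ ((degeneracyMap0 M₀ M₂ 1 2).dualMap x) + Z₃ ((degeneracyMap0 M₀ M₂ ℓ₁ 2).dualMap x))) ∧
        (∀ x ∈ periodHomology M₂, Λ₂' x =
          -(Z₂ ((degeneracyMap0 M₀ M₂ 1 2).dualMap x) + Z₄ ((degeneracyMap0 M₀ M₂ ℓ₁ 2).dualMap x))))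
    -- two-copy injectivity (Ihara, dual form) at `ℓ₂` (`M₀ → M₁`) and at `ℓ₁` (`M₀ → M₂`, first slot)
    (hinj₁ : ∀ Z ∈ 𝓛₀, ∀ Z' ∈ 𝓛₀,
      (∀ x ∈ periodHomology M₁,
        Z ((degeneracyMap0 M₀ M₁ 1 2).dualMap x) + Z' ((degeneracyMap0 M₀ M₁ ℓ₂ 2).dualMap x) = 0) →
      (∀ u ∈ periodHomology M₀, Z u = 0) ∧ (∀ u ∈ periodHomology M₀, Z' u = 0))
    (hinj₂ : ∀ Z ∈ 𝓛₀, ∀ Z' ∈ 𝓛₀,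
      (∀ x ∈ periodHomology M₂,
        Z ((degeneracyMap0 M₀ M₂ 1 2).dualMap x) + Z' ((degeneracyMap0 M₀ M₂ ℓ₁ 2).dualMap x) = 0) →
      ∀ u ∈ periodHomology M₀, Z u = 0) :
    -- CONCLUSION: the signed `hexactC`
    ∀ Λ₁ ∈ 𝓛₁, ∀ Λ₂ ∈ 𝓛₂,
      (∀ y ∈ periodHomology N,
        (Λ₁ ((degeneracyMap0 M₁ N 1 2).dualMap y) - w₁ * Λ₁ ((degeneracyMap0 M₁ N ℓ₁ 2).dualMap y)) +
        (Λ₂ ((degeneracyMap0 M₂ N 1 2).dualMap y) - w₂ * Λ₂ ((degeneracyMap0 M₂ N ℓ₂ 2).dualMap y)) = 0) →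
      ∃ Λ₀ ∈ 𝓛₀,
        (∀ x ∈ periodHomology M₁, Λ₁ x = Λ₀ ((degeneracyMap0 M₀ M₁ 1 2).dualMap x) -
          w₂ * Λ₀ ((degeneracyMap0 M₀ M₁ ℓ₂ 2).dualMap x)) ∧
        (∀ x ∈ periodHomology M₂, Λ₂ x = -(Λ₀ ((degeneracyMap0 M₀ M₂ 1 2).dualMap x) -
          w₁ * Λ₀ ((degeneracyMap0 M₀ M₂ ℓ₁ 2).dualMap x))) := by
  intro Λ₁ hΛ₁ Λ₂ hΛ₂ hrel
  obtain ⟨Z₁, hZ₁, Z₂, hZ₂, Z₃, hZ₃, Z₄, hZ₄, e1, e1', e2, e2'⟩ :=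
    hfullC Λ₁ hΛ₁ _ (hs₁ Λ₁ hΛ₁) Λ₂ hΛ₂ _ (hs₂ Λ₂ hΛ₂) (fun y hy ↦ by
      have := hrel y hy
      linear_combination this)
  -- membership of the pulled-back cycles in `H₁(X₀(M₀))`
  have hm1 : ∀ x ∈ periodHomology M₁, (degeneracyMap0 M₀ M₁ ℓ₂ 2).dualMap x ∈ periodHomology M₀ :=
    fun x hx ↦ dualMap_degeneracyMap0_mem_periodHomology M₀ M₁ ℓ₂ h01' hx
  have hm2 : ∀ x ∈ periodHomology M₂, (degeneracyMap0 M₀ M₂ ℓ₁ 2).dualMap x ∈ periodHomology M₀ :=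
    fun x hx ↦ dualMap_degeneracyMap0_mem_periodHomology M₀ M₂ ℓ₁ h02' hx
  -- from `Λ₁' = −w₁ Λ₁`: `(Z₃ + w₁ Z₁)∘d₁ + (Z₄ + w₁ Z₂)∘d_{ℓ₂} = 0` on `H₁(X₀(M₁))`
  obtain ⟨h3, -⟩ := hinj₁ _ (hlin₀ Z₃ hZ₃ Z₁ hZ₁ w₁) _ (hlin₀ Z₄ hZ₄ Z₂ hZ₂ w₁) (fun x hx ↦ by
    have a := e1' x hx
    have b := e1 x hx
    linear_combination -a - w₁ * b)
  -- from `Λ₂' = −w₂ Λ₂`: `(Z₂ + w₂ Z₁)∘d₁ + (Z₄ + w₂ Z₃)∘d_{ℓ₁} = 0` on `H₁(X₀(M₂))`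
  have h2 := hinj₂ _ (hlin₀ Z₂ hZ₂ Z₁ hZ₁ w₂) _ (hlin₀ Z₄ hZ₄ Z₃ hZ₃ w₂) (fun x hx ↦ by
    have a := e2' x hx
    have b := e2 x hx
    linear_combination a + w₂ * b)
  refine ⟨Z₁, hZ₁, fun x hx ↦ ?_, fun x hx ↦ ?_⟩
  · have b := e1 x hx
    have hz : Z₂ ((degeneracyMap0 M₀ M₁ ℓ₂ 2).dualMap x) + w₂ * Z₁ ((degeneracyMap0 M₀ M₁ ℓ₂ 2).dualMap x) = 0 := by
      simpa using h2 _ (hm1 x hx)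
    linear_combination b + hz
  · have b := e2 x hx
    have hz : Z₃ ((degeneracyMap0 M₀ M₂ ℓ₁ 2).dualMap x) + w₁ * Z₁ ((degeneracyMap0 M₀ M₂ ℓ₁ 2).dualMap x) = 0 := by
      simpa using h3 _ (hm2 x hx)
    linear_combination b - hz


/-- **THE TWO-COPY INJECTIVITY FROM IHARA'S LEMMA BY NAME.** For a non-Eisenstein maximal ideal
`𝔫 ⊂ 𝕋̃ = ℤ[T_r : r ∤ Mℓ]` of odd residue characteristic and two `k`-valued functionals `Λ, Λ'`
vanishing at `0` and SUPPORTED at `𝔫` on `H₁(X₀(M), ℤ)` (`Λ ∘ t = 0` on `H₁` for some `t ∉ 𝔫` forces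
`Λ = 0` on `H₁`): if `Λ ∘ α_* + Λ' ∘ β_* = 0` on `H₁(X₀(Mℓ), ℤ)` then `Λ = Λ' = 0` on `H₁(X₀(M), ℤ)` —
the hypotheses `hinj₁` / `hinj₂` of `signedExactCycles_of_fullExactCycles` (with `M₁ = M₀ℓ₂`,
`M₂ = M₀ℓ₁`), from the tree's named fact `ribet1984_iharaLemma` (surjectivity of `(α_*, β_*)` at `𝔫`).
[cite: Ribet1984ICM, Thm. 4.1] [cite: DarmonDiamondTaylor1995, Lemma 4.28] -/
theorem twoCopy_apply_eq_zero_of_ribet1984_iharaLemma (hI : ribet1984_iharaLemma)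
    {M ℓ : ℕ} [NeZero M] [Fact ℓ.Prime] (hℓM : ¬ ℓ ∣ M)
    (𝔫 : Ideal (HeckeRing0.primeTo M 2 (M * ℓ))) (h𝔫 : 𝔫.IsMaximal)
    (h2 : (2 : HeckeRing0.primeTo M 2 (M * ℓ)) ∉ 𝔫) (hE : ¬ HeckeRing0.primeTo.IsEisenstein 𝔫)
    (Λ Λ' : Module.Dual ℂ (CuspForm (Gamma0 M) 2) → k) (hΛ0 : Λ 0 = 0) (hΛ'0 : Λ' 0 = 0)
    (hsupp : ∀ t : HeckeRing0.primeTo M 2 (M * ℓ), t ∉ 𝔫 →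
      (∀ x ∈ periodHomology M, Λ ((t : HeckeRing0 M 2) • x) = 0) → ∀ x ∈ periodHomology M, Λ x = 0)
    (hsupp' : ∀ t : HeckeRing0.primeTo M 2 (M * ℓ), t ∉ 𝔫 →
      (∀ x ∈ periodHomology M, Λ' ((t : HeckeRing0 M 2) • x) = 0) → ∀ x ∈ periodHomology M, Λ' x = 0)
    (hvan : ∀ z ∈ periodHomology (M * ℓ),
      Λ ((degeneracyMap0 M (M * ℓ) 1 2).dualMap z) + Λ' ((degeneracyMap0 M (M * ℓ) ℓ 2).dualMap z) = 0) :
    (∀ x ∈ periodHomology M, Λ x = 0) ∧ (∀ x ∈ periodHomology M, Λ' x = 0) := by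
  obtain ⟨s, hs, hsurj⟩ := hI M ℓ hℓM 𝔫 h𝔫 h2 hE
  refine ⟨hsupp s hs fun x hx ↦ ?_, hsupp' s hs fun y hy ↦ ?_⟩
  · obtain ⟨z, hz, hα, hβ⟩ := hsurj x hx 0 (periodHomology M).zero_mem
    have h := hvan z hz
    rw [hα, hβ, smul_zero, hΛ'0, add_zero] at h
    exact h
  · obtain ⟨z, hz, hα, hβ⟩ := hsurj 0 (periodHomology M).zero_mem y hy
    have h := hvan z hz
    rw [hα, hβ, smul_zero, hΛ0, zero_add] at h
    exact h

end CyclesBridge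

end Summit.BirchSwinnertonDyer.Rank1Residual.LevelLowering

end
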